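import Literature.Analysis.FluidPDE.GalerkinFlow
import Summits.AnomalousDissipation.AnomalousDissipation.Theses.WazewskiBlock
import Summits.AnomalousDissipation.AnomalousDissipation.Theorems.WazewskiBlockUniformGalerkinTrapLandingEquivalence
import HarnessLib

/-!
# Sketch — crux-ideate stmt-AnomalousDissipation-10352 (`WazewskiBlock.UniformGalerkinTrap`), round 2, ideator 5

First lemmas of the crux idea card `mane-calibrated-injection-floor`.

* `floor_of_boundedDeficit` (PROVED, pure real analysis): a time-`L`-Lipschitz signal whose cumulative
  DEFICIT below the level `β` is bounded by `C` on every window never dips below `β - √(2 C L)`.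
  (A dip of depth `d` at time `t₀` forces `w ≤ β - d + L (τ - t₀)` on `[t₀, t₀ + d/L]`, a deficit `d²/(2L)`.)
* `calibrated_of_boundedExcess` (stated; M-sized, Mathlib only — Mañé's coboundary lemma on the support of a
  maximizing measure, semiflow form): if `μ` is `φ`-invariant with `∫ W dμ = β` and the `β`-EXCESS of `W` along
  orbits is bounded by `C`, then `μ`-a.e. orbit has `β`-DEFICIT bounded by `C` on every window.
* `BoundedExcessLoudCore` (the card's Transfer `C⁺`, typed over `Torus.galerkinFlow` and Borel measures on fields),
  `BoundedDeficitLoudCore` (its orbit-level consequence), and the transfer shape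
  `uniformGalerkinTrap_of_boundedDeficitLoudCore` (PROVED: `floor_of_boundedDeficit` + forward invariance of the
  orbit + the landed `uniformGalerkinTrap_iff_windowInvariantSets`, p105977).
-/

-- `Summit.<Summit>.<Problem>` is the mandated summit-side namespace (CONVENTIONS §2); deliberate duplicate.
set_option linter.dupNamespace false

namespace Summit.AnomalousDissipation.AnomalousDissipation.Cruxes.UniformGalerkinTrap.Ideator5

open scoped InnerProductSpace ENNReal NNReal
open MeasureTheory Set Filter Topology
open Literature.Analysis.FunctionSpaces Literature.Analysis.FunctionSpaces.Torus
open Literature.Analysis.FluidPDE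
open Summit.AnomalousDissipation.AnomalousDissipation.Theorems.UniformGalerkinTrap
  (uniformGalerkinTrap_iff_windowInvariantSets)

local notation "𝕋³" => UnitAddTorus (Fin 3)
local notation "E³" => EuclideanSpace ℝ (Fin 3)

/-! ### 1. The deficit–Lipschitz floor lemma (PROVED) -/

/-- **Bounded deficit + time-Lipschitz ⇒ pointwise floor.** Let `w : ℝ → ℝ` be continuous on `[0,∞)` and
`L`-Lipschitz there, and suppose its cumulative deficit below the level `β` is bounded by `C ≥ 0` on EVERY
window: `β (t - s) - C ≤ ∫_s^t w` for `0 ≤ s ≤ t` (no sign assumption on `C` is needed).  Then `w t ≥ β - √(2 C L)` for all `t ≥ 0`.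
Proof: if `w t₀ = β - d` with `d > 0`, then on `[t₀, t₀ + d/L]` the Lipschitz bound gives
`w τ ≤ β - d + L (τ - t₀)`, whose integral is `β d/L - d²/(2L)`; the deficit hypothesis forces `d²/(2L) ≤ C`. -/
theorem floor_of_boundedDeficit {w : ℝ → ℝ} {L C β : ℝ} (hL : 0 < L)
    (hcont : ContinuousOn w (Ici 0))
    (hlip : ∀ s t : ℝ, 0 ≤ s → 0 ≤ t → |w t - w s| ≤ L * |t - s|)
    (hdef : ∀ s t : ℝ, 0 ≤ s → s ≤ t → β * (t - s) - C ≤ ∫ τ in s..t, w τ) :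
    ∀ t : ℝ, 0 ≤ t → β - Real.sqrt (2 * C * L) ≤ w t := by
  intro t₀ ht₀
  set d : ℝ := β - w t₀ with hd
  by_cases hdle : d ≤ 0
  · have h0 : 0 ≤ Real.sqrt (2 * C * L) := Real.sqrt_nonneg _
    linarith
  push Not at hdle
  set h : ℝ := d / L with hh
  have hhpos : 0 < h := div_pos hdle hL
  have hLh : L * h = d := by rw [hh]; field_simp
  -- the affine majorant on the window `[t₀, t₀ + h]`
  have hle : ∀ τ ∈ Icc t₀ (t₀ + h), w τ ≤ (β - d) + L * (τ - t₀) := by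
    intro τ hτ
    have hτ0 : 0 ≤ τ := le_trans ht₀ hτ.1
    have h1 := hlip t₀ τ ht₀ hτ0
    have habs : |τ - t₀| = τ - t₀ := abs_of_nonneg (by linarith [hτ.1])
    rw [habs] at h1
    have h2 : w τ - w t₀ ≤ L * (τ - t₀) := le_trans (le_abs_self _) h1
    have hw0 : w t₀ = β - d := by rw [hd]; ring
    linarith
  -- integrability on the window
  have hIcc : Icc t₀ (t₀ + h) ⊆ Ici 0 := fun τ hτ => le_trans ht₀ hτ.1
  have hwint : IntervalIntegrable w volume t₀ (t₀ + h) := by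
    apply ContinuousOn.intervalIntegrable
    rw [uIcc_of_le (by linarith)]
    exact hcont.mono hIcc
  have hgcont : Continuous fun τ : ℝ => (β - d) + L * (τ - t₀) := by fun_prop
  have hgint : IntervalIntegrable (fun τ : ℝ => (β - d) + L * (τ - t₀)) volume t₀ (t₀ + h) :=
    hgcont.intervalIntegrable _ _
  -- the integral of the majorant, by the fundamental theorem of calculus
  have hderiv : ∀ τ ∈ uIcc t₀ (t₀ + h),
      HasDerivAt (fun τ : ℝ => (β - d - L * t₀) * τ + L / 2 * τ ^ 2) ((β - d) + L * (τ - t₀)) τ := by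
    intro τ _
    have h1 : HasDerivAt (fun τ : ℝ => (β - d - L * t₀) * τ) (β - d - L * t₀) τ := by
      simpa using (hasDerivAt_id τ).const_mul (β - d - L * t₀)
    have h2 : HasDerivAt (fun τ : ℝ => L / 2 * τ ^ 2) (L / 2 * (2 * τ)) τ := by
      have h3 := (hasDerivAt_pow 2 τ).const_mul (L / 2)
      simpa using h3
    exact (h1.add h2).congr_deriv (by ring)
  have hgval : ∫ τ in t₀..(t₀ + h), ((β - d) + L * (τ - t₀)) = (β - d) * h + L * h ^ 2 / 2 := by
    rw [intervalIntegral.integral_eq_sub_of_hasDerivAt hderiv hgint]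
    ring
  -- compare with the deficit hypothesis on the same window
  have hup : ∫ τ in t₀..(t₀ + h), w τ ≤ (β - d) * h + L * h ^ 2 / 2 := by
    rw [← hgval]
    exact intervalIntegral.integral_mono_on (by linarith) hwint hgint hle
  have hlow := hdef t₀ (t₀ + h) ht₀ (by linarith)
  have hkey : (β - d) * h + L * h ^ 2 / 2 = β * h - d ^ 2 / (2 * L) := by
    rw [hh]; field_simp; ring
  have hsq : d ^ 2 / (2 * L) ≤ C := by nlinarith [hup, hlow, hkey]
  have hsq' : d ^ 2 ≤ 2 * C * L := by
    have h2L : 0 < 2 * L := by positivity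
    have := (div_le_iff₀ h2L).mp hsq
    nlinarith [this]
  have hdroot : d ≤ Real.sqrt (2 * C * L) := by
    rw [show d = Real.sqrt (d ^ 2) from (Real.sqrt_sq hdle.le).symm]
    exact Real.sqrt_le_sqrt hsq'
  linarith

/-! ### 2. Mañé's coboundary lemma on the support of a maximizing measure (semiflow form; STATED) -/

/-- **Calibration from bounded excess (Mañé's lemma, semiflow/measure form).** Let `φ` be a measurable
semiflow on `X`, `μ` a `φ`-invariant probability measure, `W` a bounded measurable observable, continuous in
time along orbits, with mean `∫ W dμ = β`, and suppose the cumulative EXCESS of `W` above `β` along `μ`-a.e.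
orbit is bounded: `∫₀ᵗ W(φ_τ x) dτ ≤ β t + C` (`t ≥ 0`).  Then `μ`-a.e. orbit is CALIBRATED: its cumulative
DEFICIT below `β` on every window is bounded by the same `C`.
Proof (M, Mathlib only): `V(x) := sup_{t ∈ ℚ≥0} ∫₀ᵗ (W∘φ_τ(x) - β) dτ ∈ [0, C]` is measurable and a sub-action,
`V x ≥ ∫₀ᵗ (W∘φ - β) + V (φ_t x)`; the defect `Δ_t := β t + V - V∘φ_t - ∫₀ᵗ W∘φ ≥ 0` has `∫ Δ_t dμ = 0` by
invariance, so `Δ_t = 0` a.e.; countably many `t` and continuity in `t` give, a.e., `∫_s^t W∘φ = β (t - s) +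
V(φ_s x) - V(φ_t x) ≥ β (t - s) - C` for all `0 ≤ s ≤ t` (Mañé 1996; Contreras–Lopes–Thieullen 2001 §2;
Lopes–Thieullen, ETDS 25 (2005) 605, Thm 1 for flows; Jenkinson, DCDS 15 (2006) 197, Prop. 2.1–2.2).
[cite: Jenkinson2006, Prop. 2.1–2.2] [cite: LopesThieullen2005, Thm. 1] -/
theorem calibrated_of_boundedExcess {X : Type*} [MeasurableSpace X] (φ : ℝ → X → X)
    (hmeas : ∀ t, 0 ≤ t → Measurable (φ t)) (h0 : ∀ x, φ 0 x = x)
    (hsemi : ∀ s t : ℝ, 0 ≤ s → 0 ≤ t → ∀ x, φ (s + t) x = φ s (φ t x))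
    (μ : Measure X) [IsProbabilityMeasure μ] (hinv : ∀ t, 0 ≤ t → μ.map (φ t) = μ)
    (W : X → ℝ) (hWm : Measurable W) (hWb : ∃ B, ∀ x, |W x| ≤ B)
    (hWc : ∀ x, ContinuousOn (fun t => W (φ t x)) (Ici 0))
    {β C : ℝ} (hmean : ∫ x, W x ∂μ = β)
    (hexcess : ∀ᵐ x ∂μ, ∀ t : ℝ, 0 ≤ t → ∫ τ in (0 : ℝ)..t, W (φ τ x) ≤ β * t + C) :
    ∀ᵐ x ∂μ, ∀ s t : ℝ, 0 ≤ s → s ≤ t → β * (t - s) - C ≤ ∫ τ in s..t, W (φ τ x) := by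
  sorry

/-! ### 3. The card's Transfer `C⁺` at Galerkin level and the transfer shape (STATED) -/

/-- The work (injection) functional `W_f(u) = ∫⟪f, u⟫`. -/
noncomputable def work (f u : 𝕋³ → E³) : ℝ := ∫ x, ⟪f x, u x⟫_ℝ

/-- The crux's force clause (`IsGalerkinMode m f` inlined, as in the route file) plus zero mean. -/
def IsForce (m : ℕ) (f : 𝕋³ → E³) : Prop :=
  (IsSmooth f ∧ IsDivFree f ∧ ∀ k : Fin 3 → ℤ, ((m : ℕ) : ℝ) ^ 2 < freqNormSq k →
    UnitAddTorus.mFourierCoeff (EuclideanSpace.complexify ∘ f) k = 0) ∧ HasZeroMean f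

/-- The bounded capped core of order `N`: Galerkin modes with energy `≤ E` and spectral enstrophy `≤ G`
(NO work clause — loudness is to be DERIVED). -/
def cappedCore (N : ℕ) (E : ℝ) (G : ℝ≥0) : Set (𝕋³ → E³) :=
  {u | IsGalerkinMode N u ∧ kineticEnergy u ≤ E ∧ eGradNormSq u ≤ (G : ℝ≥0∞)}

/-- **Transfer `C⁺` (statistical form): `BoundedExcessLoudCore`.** For some trig-polynomial force and window
constants there are a top injection level `β`, an excess budget `C` and a time-Lipschitz constant `L` with
`√(2 C L) ≤ β - ε₀` such that for every small `ν` and every large order `N` the Galerkin semiflow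
`Torus.galerkinFlow ν f N` carries an INVARIANT Borel probability measure supported in the bounded capped
core whose mean injection is `β`, along whose a.e. orbit the injection is `L`-Lipschitz in time and has
`β`-EXCESS bounded by `C`.  (No pointwise loudness is assumed anywhere.) -/
def BoundedExcessLoudCore : Prop :=
  ∃ (m : ℕ) (f : 𝕋³ → E³), IsForce m f ∧ ∃ (E ε₀ ν₀ β C L : ℝ), 0 < ε₀ ∧ 0 < ν₀ ∧ 0 ≤ C ∧ 0 < L ∧
    Real.sqrt (2 * C * L) ≤ β - ε₀ ∧
    ∀ ν : ℝ, 0 < ν → ν ≤ ν₀ → ∃ (G : ℝ≥0) (N₀ : ℕ), ∀ N : ℕ, N₀ ≤ N →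
      ∃ μ : Measure (𝕋³ → E³), IsProbabilityMeasure μ ∧
        (∀ t : ℝ, 0 ≤ t → μ.map (Torus.galerkinFlow ν f N t) = μ) ∧
        μ (cappedCore N E G)ᶜ = 0 ∧
        ∫ u, work f u ∂μ = β ∧
        (∀ᵐ u ∂μ, ∀ s t : ℝ, 0 ≤ s → 0 ≤ t →
          |work f (Torus.galerkinFlow ν f N t u) - work f (Torus.galerkinFlow ν f N s u)| ≤ L * |t - s|) ∧
        (∀ᵐ u ∂μ, ∀ t : ℝ, 0 ≤ t →
          ∫ τ in (0 : ℝ)..t, work f (Torus.galerkinFlow ν f N τ u) ≤ β * t + C)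

/-- **Orbit-level consequence: `BoundedDeficitLoudCore`** — one point of the capped core per `(ν, N)` whose
forward Galerkin orbit stays capped and bounded, with `L`-Lipschitz injection and `β`-DEFICIT `≤ C` on every
window, `√(2 C L) ≤ β - ε₀`.  (`BoundedExcessLoudCore → BoundedDeficitLoudCore` is
`calibrated_of_boundedExcess` + "an a.e. property on a set of full measure has a witness in the core".) -/
def BoundedDeficitLoudCore : Prop :=
  ∃ (m : ℕ) (f : 𝕋³ → E³), IsForce m f ∧ ∃ (E ε₀ ν₀ β C L : ℝ), 0 < ε₀ ∧ 0 < ν₀ ∧ 0 ≤ C ∧ 0 < L ∧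
    Real.sqrt (2 * C * L) ≤ β - ε₀ ∧
    ∀ ν : ℝ, 0 < ν → ν ≤ ν₀ → ∃ (G : ℝ≥0) (N₀ : ℕ), ∀ N : ℕ, N₀ ≤ N →
      ∃ a ∈ cappedCore N E G,
        (∀ t : ℝ, 0 ≤ t → Torus.galerkinFlow ν f N t a ∈ cappedCore N E G) ∧
        (∀ s t : ℝ, 0 ≤ s → 0 ≤ t →
          |work f (Torus.galerkinFlow ν f N t a) - work f (Torus.galerkinFlow ν f N s a)| ≤ L * |t - s|) ∧
        (∀ s t : ℝ, 0 ≤ s → s ≤ t →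
          β * (t - s) - C ≤ ∫ τ in s..t, work f (Torus.galerkinFlow ν f N τ a))

/-- **Statistical ⇒ orbit level** (M): `calibrated_of_boundedExcess` applied to `φ := Torus.galerkinFlow ν f N`
(measurable and a semiflow on Galerkin modes: `galerkinFlow_zero/_add`, `continuousOn_galerkinPhaseFlow`), then
pick a point of the full-measure set inside the core (`μ (cappedCore)ᶜ = 0`, `μ univ = 1`); invariance of the
support keeps the orbit in the core. -/
theorem boundedDeficitLoudCore_of_boundedExcessLoudCore :
    BoundedExcessLoudCore → BoundedDeficitLoudCore := by
  sorry

/-- **Transfer: `BoundedDeficitLoudCore → UniformGalerkinTrap`** (PROVED).  For the witness `a`, the signal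
`w t := work f (galerkinFlow ν f N t a)` is continuous on `[0,∞)` (clause (a) of `galerkinFlow_clauses` tested
against `f`), `L`-Lipschitz and has `β`-deficit `≤ C`, so `floor_of_boundedDeficit` gives `w t ≥ β - √(2CL) ≥ ε₀`
for all `t ≥ 0`; the forward orbit `S := {galerkinFlow ν f N t a | t ≥ 0}` is nonempty, consists of Galerkin
modes, is forward invariant (`IsGalerkinMode.galerkinFlow_add`) and lies in the window
`{KE ≤ E} ∩ {work ≥ ε₀} ∩ {eGradNormSq ≤ G}`; conclude by the landed
`uniformGalerkinTrap_iff_windowInvariantSets` (p105977). -/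
theorem uniformGalerkinTrap_of_boundedDeficitLoudCore :
    BoundedDeficitLoudCore →
      Summit.AnomalousDissipation.AnomalousDissipation.Theses.WazewskiBlock.UniformGalerkinTrap := by
  rintro ⟨m, f, hF, E, ε₀, ν₀, β, C, L, hε₀, hν₀, _hC, hL, hgap, h⟩
  rw [uniformGalerkinTrap_iff_windowInvariantSets]
  refine ⟨m, f, hF, E, ε₀, ν₀, hε₀, hν₀, fun ν hν hνle => ?_⟩
  obtain ⟨G, N₀, hN⟩ := h ν hν hνle
  refine ⟨G, N₀, fun N hN₀ => ?_⟩
  obtain ⟨a, ha, horb, hlip, hdef⟩ := hN N hN₀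
  have hfi : Integrable f volume := (hF.1.1.memLp 2).integrable one_le_two
  have hmode : IsGalerkinMode N a := ha.1
  -- the pointwise floor along the orbit, from the deficit–Lipschitz lemma
  have hfloor : ∀ t : ℝ, 0 ≤ t → ε₀ ≤ work f (Torus.galerkinFlow ν f N t a) := by
    have hcont : ContinuousOn (fun t => work f (Torus.galerkinFlow ν f N t a)) (Ici 0) := by
      rw [Metric.continuousOn_iff]
      intro t ht ε hε
      refine ⟨ε / L, div_pos hε hL, fun s hs hst => ?_⟩
      rw [Real.dist_eq]
      have h1 : |work f (Torus.galerkinFlow ν f N s a) - work f (Torus.galerkinFlow ν f N t a)| ≤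
          L * |s - t| := hlip t s ht hs
      have h2 : |s - t| < ε / L := by rwa [← Real.dist_eq]
      have h3 : L * |s - t| < L * (ε / L) := mul_lt_mul_of_pos_left h2 hL
      have h4 : L * (ε / L) = ε := by field_simp
      linarith
    have key := floor_of_boundedDeficit (β := β) (C := C) hL hcont hlip hdef
    intro t ht
    have := key t ht
    linarith
  refine ⟨(fun t => Torus.galerkinFlow ν f N t a) '' Ici 0,
    ⟨a, 0, mem_Ici.2 le_rfl, Torus.galerkinFlow_zero a⟩, ?_, ?_, ?_⟩
  · rintro b ⟨τ, _, rfl⟩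
    exact hmode.isGalerkinMode_galerkinFlow τ
  · rintro b ⟨τ, hτ, rfl⟩ t ht
    exact ⟨t + τ, mem_Ici.2 (add_nonneg ht hτ), hmode.galerkinFlow_add hν.le hfi ht hτ⟩
  · rintro b ⟨τ, hτ, rfl⟩
    obtain ⟨-, hKE, hZ⟩ := horb τ hτ
    exact ⟨hKE, hfloor τ hτ, hZ⟩

end Summit.AnomalousDissipation.AnomalousDissipation.Cruxes.UniformGalerkinTrap.Ideator5
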